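import Summits.QuantumFields.BalabanUV.Beta.EriceRemainderEnclosureHistoryAutonomyComparisonTowerLemmas

/-!
# EriceRemainderEnclosureHistoryAutonomyComparisonTower — (E62b) HYPER-SEPARATED TOWERS OF ANY HEIGHT COMPARE AT ANY SIZE: `B(u) = b + Σ_{k∈A} L_k·u_k`
# with `L_k ≥ 0` of ANY sizes on ANY finite set `A` of `n` ages `≥ 1` whose pairwise ratios are at most `t`, **`(n² + 4)·t ≤ 2·(1 − √2∕2)^n`**
# (three ages: consecutive ratios `≥ 260`), and every `B′ ≥ B` with a zeroth moment and an ISOTONE excess: ANY box solutions from one pin satisfy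
# `h′ ≤ h` at every scale (`le_of_isotone_excess_tower`, `le_of_isotone_excess_tower_ratio`, `le_of_isotone_excess_three_ages_far`) — THE STEP by
# PEELING THE AGES ONE BY ONE, the budget left to the younger ages shrinking by the factor `1 − (√2∕2)(1 − 2t)` per age (the ZONE PRODUCT LAW, (E62a)
# `budget`): the first class of the comparison column BEYOND TWO AGES that no level-weight ∕ certificate ∕ barrier bookkeeping reaches (towers of
# `n ≥ 3` hyper-separated unit blocks carry kernel mass `T > 1`, `HOME/b2b-balaban-beta-d4-p2/g54/e61/README.md`)

Cell `pub-balaban`, β-function sub-cell, BINDER row D4 «RemainderConst leaves for Bałaban's split» (`HOME/BINDER-OWNERS.md`; owner lineage `b2b-balaban-beta-an4`;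
this file by co-owner #2 lineage `b2b-balaban-beta-d4-p2`, generation 55), β-FLOW TEAM duty (1), FREEZE (0) honoured (def-free; (E62a)'s `sum_support` ∕
`accel_sqrt_two_at` ∕ `drop_le` ∕ `old_drop_window` ∕ `window_sum_ge` ∕ `budget` ∕ `t_lt_half` ∕ `assembly_le`, (E58a)'s `le_of_isotone_excess_of_step`, (E49j)'s
`excess_shift_le`, (E48a)'s `strictAnti_of_memFlow`, (E41)'s `affine_monotone` ∕ `affine_floor` ∕ `affine_zerothMoment`, node U2's `SeqBox` ∕ `MemFlow` ∕
`Sharpness.abs_sub_le_half_cube_mul` BY NAME; nothing restated).  Sequel of (E59d)∕(E59e) (ANY two affine ages compare at any size); answers, in the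
hyper-separated regime, the question left there and in `HOME/b2b-balaban-beta-d4-p2/g51/e58/README.md` («three or more ages — the peeling recursion and its
constants are the successor's»).

HONEST FRAMING (page 1, verbatim and binding).  *"Discharging BetaPertH makes Bałaban's UV stability UNCONDITIONAL — a real constructive-QFT result; it is
NOT the continuum limit and NOT the Clay problem."*  THIS FILE DISCHARGES NOTHING OF THE KIND.  Elementary real analysis about ABSTRACT affine functionals on
a box ]0,γ]^ℕ with displayed supports and signs — hypotheses of a census, not facts; the form, signs, ages and moments of Bałaban's (1.22) limit functional
are NOT PRINTED ([I] p. 298; GAPS G-t4-U2-1∕-2) and NOT asserted.  Row D4 class UNCHANGED (critical-path width 0; instance 0∕1; D4 DISCHARGE NO DATE).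
HONEST DEPENDENCY: continuum YM on T⁴ ⇐ BetaPertH ∧ nine spine estimates (0/9 proved); BetaPertH ⇐ (D1) ∧ (D4) ∧ CAP+tail; G-an2-4 gates asym, D1 and
NE2/3/4.

THE POINT (census sense (α); the COMPARISON column of the autonomy row).  By (E58a) comparison at any size is THE STEP: along box solutions `h′ ≤ h` of
`B′ ≥ B`, `B` from one pin `y`, the drop `d₀ = B h − B h′ = Σ_{k∈A} D_k`, `D_k = L_k·(h_k − h′_k)`, is at most the excess `η = (B′ − B)(h′)`.  §1 proves it
for hyper-separated supports by the TRIANGULAR SYSTEM of (E62a): for every age `k ∈ A`, **`D_k ≤ c·η₊ − c(1 − 2t)·Σ_{k′∈A, k′>k} D_{k′}`** (`c = √2∕2`,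
`η₊ = η(1 + n²t∕2)`) — the young drop is `≤ (c∕k)·δ_k` (acceleration), the young level gap is `δ_k ≤ k·η − Σ_{l≤k} d_l` (increment identity), and over
the young window every OLDER age drops by at least `(1 − 2t)·D_{k′} − c·t·D̄` ((E62a) `old_drop_window`, `D̄ = n·c·η` bounding every drop read,
(E62a) `drop_le`) — whence (E62a) `budget`: `(1 − 2t)·d₀ ≤ η₊·(1 − θ^n)`, `θ = 1 − c(1−2t)`, and (E62a) `assembly_le`: `≤ η·(1 − 2t)` under
`(n² + 4)·t ≤ 2·(1 − c)^n`.  §2: the comparison theorems by (E58a)'s principle — for a finite support with real ratio bound `t`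
(`le_of_isotone_excess_tower`), with an integer ratio `R` between any two ages, `n² + 4 ≤ 2R·(1 − √2∕2)^n` (`le_of_isotone_excess_tower_ratio`:
`R ≥ 47, 260, 1400, 6800, …` for `n = 2, 3, 4, 5, …`), and THREE ages `k₁ < k₂ < k₃` with `k₂ ≥ 260·k₁`, `k₃ ≥ 260·k₂`, sizes `L₁, L₂, L₃` ARBITRARY
(`le_of_isotone_excess_three_ages_far`).  So the comparison column now reads: zeroth moment alone ⟺ `M·γ ≤ 3√3·b`; one age, profiles with
`Σ_j L_j∕P_j ≤ 2`, fading profiles, uniform windows, ANY two ages — free; and HYPER-SEPARATED TOWERS OF ANY HEIGHT — free: the budget of the excess is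
consumed MULTIPLICATIVELY, zone by zone, never additively — which is why no bookkeeping with a fixed margin could reach it (numerically the true step
quantity of `n` unit blocks is `≈ 0.56^n·η > 0`, `HOME/b2b-balaban-beta-d4-p2/g55/e62/README.md`).  NOT CLAIMED: three or more ages at ratios below the
threshold (conjecture (E58′) OPEN there — the measured per-zone factor `≈ 0.56` against the proved `1 − (√2∕2)(1−2t) → 0.29`), Markov terms or dense
blocks riding along (harmless numerically, untyped), necessity, anything printed.

WHAT IS PROVED ([folklore]; 0 `def`, 0 sorry).  §1 **`effective_le_of_family_le_at_tower`** (THE STEP).  §2 **`le_of_isotone_excess_tower`**,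
**`le_of_isotone_excess_tower_ratio`**, `card_triple`, **`le_of_isotone_excess_three_ages_far`**.
-/
noncomputable section
open Finset Set

namespace Summit.QuantumFields.BalabanUV.Beta.EriceRemainderEnclosureHistoryAutonomyComparisonTower

open Literature.MathematicalPhysics.QuantumFieldTheory.Balaban1983to89
open Literature.MathematicalPhysics.QuantumFieldTheory.Balaban1983to89.T4BetaStationary
open Literature.MathematicalPhysics.QuantumFieldTheory.Balaban1983to89.T4BetaFlowWellPosed
open Literature.MathematicalPhysics.QuantumFieldTheory.Balaban1983to89.T4BetaFlowWellPosed.Sharpness (abs_sub_le_half_cube_mul)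
open Summit.QuantumFields.BalabanUV.Beta.EriceRemainderEnclosureHistoryAutonomyOrder (strictAnti_of_memFlow)
open Summit.QuantumFields.BalabanUV.Beta.EriceRemainderEnclosureHistoryAutonomyComparisonExcess (excess_shift_le)
open Summit.QuantumFields.BalabanUV.Beta.EriceRemainderEnclosureHistoryAutonomyComparisonPrinciple (le_of_isotone_excess_of_step)
open Summit.QuantumFields.BalabanUV.Beta.EriceRemainderEnclosureHistoryAutonomyMonotone (affine_monotone affine_floor affine_zerothMoment)
open Summit.QuantumFields.BalabanUV.Beta.EriceRemainderEnclosureHistoryAutonomyComparisonTwoAgesLemmas (sqrt_two_lt)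
open Summit.QuantumFields.BalabanUV.Beta.EriceRemainderEnclosureHistoryAutonomyComparisonTowerLemmas

variable {B' : (ℕ → ℝ) → ℝ} {M' γ b y t : ℝ} {L : ℕ → ℝ} {K : ℕ} {h h' : ℕ → ℝ} {A : Finset ℕ}

/-! ## §1 THE STEP for a hyper-separated support, ANY sizes -/

/-- **THE STEP FOR A HYPER-SEPARATED TOWER OF ANY HEIGHT.**  `B(u) = b + Σ_{k<K} L_k·u_k` with `L ≥ 0` supported on a finite set `A ⊆ [1, K[` of `n = #A`
ages whose pairwise ratios are at most `t ≥ 0` (`k ≤ t·k′` for `k < k′` in `A`) with `(n² + 4)·t ≤ 2·(1 − √2∕2)^n` — the sizes `L_k`, `k ∈ A`, ARBITRARY;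
`B ≤ B′` on the box with ISOTONE excess; `h`, `h′` box solutions of `B`, `B′` from one pin `y` with `h′ ≤ h` at every scale.  Then `B h ≤ B′ h′`.  (Peeling the
ages one by one through (E62a)'s triangular system and budget recursion; see the module header.) [folklore] -/
theorem effective_le_of_family_le_at_tower (hL : ∀ k, 0 ≤ L k) (hb : 0 < b) (hAK : A ⊆ range K) (hA1 : ∀ k ∈ A, 1 ≤ k)
    (hsupp : ∀ k ∈ range K, k ∉ A → L k = 0) (ht0 : 0 ≤ t) (hsep : ∀ k ∈ A, ∀ k' ∈ A, k < k' → (k : ℝ) ≤ t * k')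
    (ht : ((A.card : ℝ) ^ 2 + 4) * t ≤ 2 * (1 - Real.sqrt 2 / 2) ^ A.card)
    (hexc : ∀ u, SeqBox γ u → (fun u : ℕ → ℝ => b + ∑ k ∈ range K, L k * u k) u ≤ B' u)
    (hDmono : ∀ u v : ℕ → ℝ, SeqBox γ u → SeqBox γ v → (∀ j, u j ≤ v j) →
      B' u - (fun u : ℕ → ℝ => b + ∑ k ∈ range K, L k * u k) u ≤ B' v - (fun u : ℕ → ℝ => b + ∑ k ∈ range K, L k * u k) v)
    (hy : 0 < y) (hh : SeqBox γ h) (hf : MemFlow (fun u : ℕ → ℝ => b + ∑ k ∈ range K, L k * u k) y h) (hh' : SeqBox γ h')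
    (hf' : MemFlow B' y h') (hle : ∀ j, h' j ≤ h j) :
    (fun u : ℕ → ℝ => b + ∑ k ∈ range K, L k * u k) h ≤ B' h' := by
  set B : (ℕ → ℝ) → ℝ := fun u : ℕ → ℝ => b + ∑ k ∈ range K, L k * u k with hB_def
  have hlo : ∀ u, SeqBox γ u → b ≤ B u := affine_floor hL
  have hlo' : ∀ u, SeqBox γ u → b ≤ B' u := fun u hu => (hlo u hu).trans (hexc u hu)
  have hanti' : Antitone h' := (strictAnti_of_memFlow hb hlo' hh' hf').antitone
  -- the excess at the pin and along h′
  set η : ℝ := B' h' - B h' with hη_def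
  have hη0 : 0 ≤ η := by rw [hη_def]; linarith [hexc h' hh']
  have hηs : ∀ n, |B (fun j => h' (n + 1 + j)) - B' (fun j => h' (n + 1 + j))| ≤ η := excess_shift_le hexc hDmono hh' hanti'
  -- gaps and level gaps
  have hg0 : ∀ n, 0 ≤ h n - h' n := fun n => by linarith [hle n]
  set δ : ℕ → ℝ := fun n => 1 / h' n ^ 2 - 1 / h n ^ 2 with hδ_def
  have hδ0 : ∀ n, 0 ≤ δ n := fun n =>
    sub_nonneg.mpr (one_div_le_one_div_of_le (pow_pos (hh' n).1 2) (pow_le_pow_left₀ (hh' n).1.le (hle n) 2))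
  have hgδ : ∀ n, h n - h' n ≤ h n ^ 3 / 2 * δ n := by
    intro n
    have hw := abs_sub_le_half_cube_mul (hh n).1 (hh' n).1 le_rfl (hle n)
    rw [abs_of_nonneg (hg0 n), abs_sub_comm, abs_of_nonneg (hδ0 n)] at hw
    exact hw
  -- the drop read at scale n
  set dd : ℕ → ℝ := fun n => ∑ k ∈ A, L k * (h (n + k) - h' (n + k)) with hdd_def
  have hdrop_eq : ∀ n, B (fun j => h (n + j)) - B (fun j => h' (n + j)) = dd n := by
    intro n
    simp only [hB_def, hdd_def]
    rw [add_sub_add_left_eq_sub, ← sum_sub_distrib,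
      show ∑ x ∈ range K, (L x * h (n + x) - L x * h' (n + x)) = ∑ x ∈ range K, L x * (h (n + x) - h' (n + x)) from
        sum_congr rfl fun x _ => by ring,
      sum_support hAK hsupp]
  have hdd0 : ∀ n, 0 ≤ dd n := fun n => sum_nonneg fun k _ => mul_nonneg (hL k) (hg0 _)
  -- the increment identity: δ(n+1) − δ(n) = excess_n − dd(n+1), 0 ≤ excess_n ≤ η
  have hinc : ∀ n, δ (n + 1) - δ n ≤ η - dd (n + 1) ∧ -dd (n + 1) ≤ δ (n + 1) - δ n := by
    intro n
    have e1 := hf.2 n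
    have e2 := hf'.2 n
    have hd := hdrop_eq (n + 1)
    have ex1 := (abs_le.mp (hηs n)).1
    have ex0 : B (fun j => h' (n + 1 + j)) ≤ B' (fun j => h' (n + 1 + j)) := hexc _ (seqBox_shift hh' (n + 1))
    simp only [hδ_def]
    constructor <;> linarith
  have hδ_zero : δ 0 = 0 := by simp only [hδ_def]; rw [hf.1, hf'.1]; ring
  have hδle : ∀ n : ℕ, δ n ≤ (n : ℝ) * η := by
    intro n
    induction n with
    | zero => rw [hδ_zero]; simp
    | succ n ih =>
      have := (hinc n).1
      have := hdd0 (n + 1)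
      rw [Nat.cast_succ]; linarith
  have hδup : ∀ m : ℕ, δ m ≤ (m : ℝ) * η - ∑ l ∈ range m, dd (l + 1) := by
    intro m
    induction m with
    | zero => rw [hδ_zero]; simp
    | succ m ih =>
      have := (hinc m).1
      rw [Nat.cast_succ, sum_range_succ]; linarith
  have hδdown : ∀ n l : ℕ, δ n - ∑ i ∈ range l, dd (n + 1 + i) ≤ δ (n + l) := by
    intro n l
    induction l with
    | zero => simp
    | succ l ih =>
      have := (hinc (n + l)).2
      rw [sum_range_succ, show n + (l + 1) = n + l + 1 by ring, show n + 1 + l = n + l + 1 by ring]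
      linarith
  -- the numerical side conditions (before abbreviating): 0 ≤ 1 − 2t; t < 1∕2 for a nonempty support; the assembly inequality
  have htlt : A.Nonempty → t < 1 / 2 := fun hA => t_lt_half (card_pos.mpr hA) ht
  have h2t : 0 ≤ 1 - 2 * t := by
    rcases A.eq_empty_or_nonempty with hA | hA
    · have h0 : A.card = 0 := by rw [hA, Finset.card_empty]
      have ht' := ht
      rw [h0] at ht'
      norm_num at ht'
      linarith
    · linarith [htlt hA]
  have hasm := assembly_le (n := A.card) ht0 hη0 ht
  -- constants: c = √2/2, the uniform drop bound D̄ = n·c·η, the enlarged budget η₊ = η(1 + n²t/2), n = #A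
  set c : ℝ := Real.sqrt 2 / 2 with hc_def
  have hc0 : 0 ≤ c := by rw [hc_def]; positivity
  have hcc : c * c = 1 / 2 := by
    rw [hc_def]; have := Real.mul_self_sqrt (show (0:ℝ) ≤ 2 by norm_num); nlinarith [this]
  have hc1 : c ≤ 1 := by rw [hc_def]; linarith [sqrt_two_lt]
  set Dbar : ℝ := (A.card : ℝ) * (c * η) with hDbar_def
  have hDbar0 : 0 ≤ Dbar := by positivity
  have hDbar : ∀ m, dd m ≤ Dbar := fun m => drop_le hL hb hy hh hf hh' hle hη0 hδle hAK hA1 m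
  set ηp : ℝ := η * (1 + (A.card : ℝ) ^ 2 * t / 2) with hηp_def
  -- the drops at the pin
  set Dk : ℕ → ℝ := fun k => L k * (h k - h' k) with hDk_def
  have hDk0 : ∀ k, 0 ≤ Dk k := fun k => mul_nonneg (hL k) (hg0 k)
  have hdrop0 : B h - B h' = ∑ k ∈ A, Dk k := by
    have := hdrop_eq 0
    simp only [hdd_def, zero_add] at this
    simpa [hDk_def] using this
  -- THE TRIANGULAR SYSTEM over the ages
  have hrec : ∀ k ∈ A, Dk k ≤ c * ηp - c * (1 - 2 * t) * ∑ k' ∈ A.filter (fun k' => k < k'), Dk k' := by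
    intro k hk
    have hk1 := hA1 k hk
    have hkK := hAK hk
    have hkr : (0 : ℝ) < k := by exact_mod_cast hk1
    set S : ℝ := ∑ k' ∈ A.filter (fun k' => k < k'), Dk k' with hS_def
    -- (i) the young drop is at most (c/k)·δ_k
    have hacc : L k * (h k ^ 3 / 2) ≤ c / k := by
      rw [hc_def, le_div_iff₀ hkr]
      have := accel_sqrt_two_at hL hb hy hh hf hkK le_rfl hk1
      linarith
    have h1 : Dk k ≤ c / k * δ k := by
      calc Dk k = L k * (h k - h' k) := by simp only [hDk_def]
        _ ≤ L k * (h k ^ 3 / 2 * δ k) := mul_le_mul_of_nonneg_left (hgδ k) (hL k)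
        _ = L k * (h k ^ 3 / 2) * δ k := by ring
        _ ≤ c / k * δ k := mul_le_mul_of_nonneg_right hacc (hδ0 k)
    -- (ii) the young level gap: δ_k ≤ k·η − Σ_{l<k} dd(l+1)
    have h2 := hδup k
    -- (iii) over the young window every older age drops by at least (1−2t)·D_{k′} − c·t·D̄
    have hW : ∀ l ∈ range k, (1 - 2 * t) * S - (A.card : ℝ) * (c * t * Dbar) ≤ dd (l + 1) := by
      intro l hl
      have hl' : l + 1 ≤ k := mem_range.mp hl
      have hold : ∀ k' ∈ A.filter (fun k' => k < k'),
          (1 - 2 * t) * Dk k' - c * t * Dbar ≤ L k' * (h (l + 1 + k') - h' (l + 1 + k')) := by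
        intro k' hk'
        obtain ⟨hk'A, hkk'⟩ := mem_filter.mp hk'
        have hk'1 := hA1 k' hk'A
        have hk'K := hAK hk'A
        have hlt : ((l + 1 : ℕ) : ℝ) ≤ t * k' := le_trans (by exact_mod_cast hl') (hsep k hk k' hk'A hkk')
        have hE : ∑ i ∈ range (l + 1), dd (k' + 1 + i) ≤ ((l + 1 : ℕ) : ℝ) * Dbar := by
          calc ∑ i ∈ range (l + 1), dd (k' + 1 + i) ≤ ∑ _i ∈ range (l + 1), Dbar := sum_le_sum fun i _ => hDbar _
            _ = ((l + 1 : ℕ) : ℝ) * Dbar := by rw [sum_const, card_range, nsmul_eq_mul]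
        have hlev : δ k' - ((l + 1 : ℕ) : ℝ) * Dbar ≤ δ (k' + (l + 1)) := by
          have hd := hδdown k' (l + 1)
          linarith
        have hwin := old_drop_window hL hb hy hh hf hh' hle hk'K hk'1 l hlt hDbar0 (by simp only [hδ_def] at hlev; exact hlev)
        rw [show l + 1 + k' = k' + (l + 1) by ring]
        simp only [hDk_def, hc_def]
        exact hwin
      have hsumold := sum_le_sum hold
      have hsub : ∑ k' ∈ A.filter (fun k' => k < k'), L k' * (h (l + 1 + k') - h' (l + 1 + k')) ≤ dd (l + 1) := by
        simp only [hdd_def]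
        exact sum_le_sum_of_subset_of_nonneg (filter_subset _ _) fun k' _ _ => mul_nonneg (hL k') (hg0 _)
      have hcount : ∑ k' ∈ A.filter (fun k' => k < k'), ((1 - 2 * t) * Dk k' - c * t * Dbar)
          = (1 - 2 * t) * S - ((A.filter (fun k' => k < k')).card : ℝ) * (c * t * Dbar) := by
        rw [sum_sub_distrib, ← mul_sum, sum_const, nsmul_eq_mul]
      have hcard : ((A.filter (fun k' => k < k')).card : ℝ) ≤ A.card := by exact_mod_cast card_filter_le _ _
      have hctD : 0 ≤ c * t * Dbar := by positivity
      have := mul_le_mul_of_nonneg_right hcard hctD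
      linarith
    -- (iv) the young window sum
    have h4 := window_sum_ge hW
    -- (v) assemble the row of the triangular system
    have h5 : Dk k ≤ c / k * ((k : ℝ) * (η - ((1 - 2 * t) * S - (A.card : ℝ) * (c * t * Dbar)))) := by
      refine h1.trans (mul_le_mul_of_nonneg_left ?_ (div_nonneg hc0 hkr.le))
      have : (k : ℝ) * (η - ((1 - 2 * t) * S - (A.card : ℝ) * (c * t * Dbar)))
          = (k : ℝ) * η - (k : ℝ) * ((1 - 2 * t) * S - (A.card : ℝ) * (c * t * Dbar)) := by ring
      rw [this]; linarith
    have e1 : c / k * ((k : ℝ) * (η - ((1 - 2 * t) * S - (A.card : ℝ) * (c * t * Dbar))))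
        = c * (η - ((1 - 2 * t) * S - (A.card : ℝ) * (c * t * Dbar))) := by field_simp
    have e2 : c * (η - ((1 - 2 * t) * S - (A.card : ℝ) * (c * t * Dbar))) = c * ηp - c * (1 - 2 * t) * S := by
      simp only [hηp_def, hDbar_def]
      linear_combination (c * (A.card : ℝ) ^ 2 * t * η) * hcc
    linarith
  -- THE BUDGET RECURSION and the numerical assembly
  have hθ : 0 ≤ 1 - c * (1 - 2 * t) := by
    have : c * (1 - 2 * t) ≤ 1 * 1 := mul_le_mul hc1 (by linarith) h2t zero_le_one
    linarith
  have hbud := budget h2t hθ A (fun k _ => hDk0 k) hrec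
  -- conclude
  have hfin : B h - B h' ≤ η := by
    rw [hdrop0]
    rcases A.eq_empty_or_nonempty with hA | hA
    · rw [hA, sum_empty]; exact hη0
    · have hpos : 0 < 1 - 2 * t := by linarith [htlt hA]
      have e : ηp * (1 - (1 - c * (1 - 2 * t)) ^ A.card)
          = η * (1 + (A.card : ℝ) ^ 2 * t / 2) * (1 - (1 - c * (1 - 2 * t)) ^ A.card) := by simp only [hηp_def]
      have hchain : (1 - 2 * t) * ∑ k ∈ A, Dk k ≤ (1 - 2 * t) * η := by linarith [hbud, hasm, e]
      exact le_of_mul_le_mul_left hchain hpos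
  rw [hη_def] at hfin
  linarith

/-! ## §2 The comparison theorems -/

/-- **HYPER-SEPARATED TOWERS OF ANY HEIGHT COMPARE AT ANY SIZE** (family-free form of §1's step by (E58a)'s principle): `B = b + Σ_{k<K} L_k·u_k` on ]0,γ] with
`b > 0`, `L ≥ 0` supported on a finite set `A ⊆ [1, K[` of `n` ages with `k ≤ t·k′` for `k < k′` in `A`, `t ≥ 0`, `(n² + 4)·t ≤ 2·(1 − √2∕2)^n` — the
sizes `L_k` ARBITRARY; `B′` with zeroth moment `M′ ≥ 0`, `B ≤ B′`, ISOTONE excess; `h`, `h′` ANY box solutions of `B`, `B′` from one pin `p ∈ ]0,γ]`.  Then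
`h′ ≤ h` at EVERY scale. [folklore] -/
theorem le_of_isotone_excess_tower {p : ℝ} (hL : ∀ k, 0 ≤ L k) (hb : 0 < b) (hAK : A ⊆ range K) (hA1 : ∀ k ∈ A, 1 ≤ k)
    (hsupp : ∀ k ∈ range K, k ∉ A → L k = 0) (ht0 : 0 ≤ t) (hsep : ∀ k ∈ A, ∀ k' ∈ A, k < k' → (k : ℝ) ≤ t * k')
    (ht : ((A.card : ℝ) ^ 2 + 4) * t ≤ 2 * (1 - Real.sqrt 2 / 2) ^ A.card)
    (hB' : ∀ u u' : ℕ → ℝ, SeqBox γ u → SeqBox γ u' → ∀ D : ℝ, (∀ j, |u j - u' j| ≤ D) → |B' u - B' u'| ≤ M' * D) (hM' : 0 ≤ M')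
    (hexc : ∀ u, SeqBox γ u → (fun u : ℕ → ℝ => b + ∑ k ∈ range K, L k * u k) u ≤ B' u)
    (hDmono : ∀ u v : ℕ → ℝ, SeqBox γ u → SeqBox γ v → (∀ j, u j ≤ v j) →
      B' u - (fun u : ℕ → ℝ => b + ∑ k ∈ range K, L k * u k) u ≤ B' v - (fun u : ℕ → ℝ => b + ∑ k ∈ range K, L k * u k) v)
    (hp : 0 < p) (hpγ : p ≤ γ) (hh : SeqBox γ h) (hf : MemFlow (fun u : ℕ → ℝ => b + ∑ k ∈ range K, L k * u k) p h)
    (hh' : SeqBox γ h') (hf' : MemFlow B' p h') (j : ℕ) : h' j ≤ h j :=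
  le_of_isotone_excess_of_step (B := fun u : ℕ → ℝ => b + ∑ k ∈ range K, L k * u k) (affine_monotone hL)
    (affine_zerothMoment hL) (sum_nonneg fun k _ => hL k) hb (affine_floor hL) hB' hM' hexc hDmono
    (fun _ hy _ _ _ hu hfu hu' hfu' hle =>
      effective_le_of_family_le_at_tower hL hb hAK hA1 hsupp ht0 hsep ht hexc hDmono hy hu hfu hu' hfu' hle)
    hp hpγ hh hf hh' hf' j

/-- **INTEGER-RATIO FORM**: the same with an integer ratio `R` between any two ages of the support (`R·k ≤ k′` for `k < k′` in `A`) and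
`n² + 4 ≤ 2R·(1 − √2∕2)^n` (`n = #A`; e.g. `R ≥ 47` for two ages, `R ≥ 260` for three, `R ≥ 1400` for four, `R ≥ 6800` for five). [folklore] -/
theorem le_of_isotone_excess_tower_ratio {p : ℝ} {R : ℕ} (hL : ∀ k, 0 ≤ L k) (hb : 0 < b) (hAK : A ⊆ range K) (hA1 : ∀ k ∈ A, 1 ≤ k)
    (hsupp : ∀ k ∈ range K, k ∉ A → L k = 0) (hsep : ∀ k ∈ A, ∀ k' ∈ A, k < k' → R * k ≤ k')
    (hR : (A.card : ℝ) ^ 2 + 4 ≤ 2 * R * (1 - Real.sqrt 2 / 2) ^ A.card)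
    (hB' : ∀ u u' : ℕ → ℝ, SeqBox γ u → SeqBox γ u' → ∀ D : ℝ, (∀ j, |u j - u' j| ≤ D) → |B' u - B' u'| ≤ M' * D) (hM' : 0 ≤ M')
    (hexc : ∀ u, SeqBox γ u → (fun u : ℕ → ℝ => b + ∑ k ∈ range K, L k * u k) u ≤ B' u)
    (hDmono : ∀ u v : ℕ → ℝ, SeqBox γ u → SeqBox γ v → (∀ j, u j ≤ v j) →
      B' u - (fun u : ℕ → ℝ => b + ∑ k ∈ range K, L k * u k) u ≤ B' v - (fun u : ℕ → ℝ => b + ∑ k ∈ range K, L k * u k) v)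
    (hp : 0 < p) (hpγ : p ≤ γ) (hh : SeqBox γ h) (hf : MemFlow (fun u : ℕ → ℝ => b + ∑ k ∈ range K, L k * u k) p h)
    (hh' : SeqBox γ h') (hf' : MemFlow B' p h') (j : ℕ) : h' j ≤ h j := by
  -- R > 0 from the separation condition (its left side is positive)
  have hRpos : (0 : ℝ) < R := by
    rcases Nat.eq_zero_or_pos R with hR0 | hR0
    · exfalso
      rw [hR0] at hR
      push_cast at hR
      nlinarith [sq_nonneg (A.card : ℝ)]
    · exact_mod_cast hR0
  refine le_of_isotone_excess_tower (t := 1 / R) hL hb hAK hA1 hsupp (by positivity) ?_ ?_ hB' hM' hexc hDmono hp hpγ hh hf hh' hf' j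
  · intro k hk k' hk' hkk'
    have := hsep k hk k' hk' hkk'
    have hcast : (R : ℝ) * k ≤ k' := by exact_mod_cast this
    rw [one_div_mul_eq_div, le_div_iff₀ hRpos]
    calc (k : ℝ) * R = (R : ℝ) * k := mul_comm _ _
      _ ≤ k' := hcast
  · rw [mul_one_div, div_le_iff₀ hRpos]
    calc (A.card : ℝ) ^ 2 + 4 ≤ 2 * R * (1 - Real.sqrt 2 / 2) ^ A.card := hR
      _ = 2 * (1 - Real.sqrt 2 / 2) ^ A.card * R := by ring

/-- Three distinct naturals make a set of card `3`. [folklore] -/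
theorem card_triple {k₁ k₂ k₃ : ℕ} (h12 : k₁ < k₂) (h23 : k₂ < k₃) : ({k₁, k₂, k₃} : Finset ℕ).card = 3 := by
  have h1 : k₁ ∉ ({k₂, k₃} : Finset ℕ) := by
    simp only [Finset.mem_insert, Finset.mem_singleton, not_or]; omega
  have h2 : k₂ ∉ ({k₃} : Finset ℕ) := by
    simp only [Finset.mem_singleton]; omega
  simp only [card_insert_of_notMem h1, card_insert_of_notMem h2, Finset.card_singleton, Nat.reduceAdd]

/-- **THREE AFFINE AGES FAR APART COMPARE AT ANY SIZE.**  `B(u) = b + L₁·u_{k₁} + L₂·u_{k₂} + L₃·u_{k₃}` on ]0,γ] (`b > 0`; `L ≥ 0` supported on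
`{k₁, k₂, k₃} ⊆ [1, K[` with `260·k₁ ≤ k₂`, `260·k₂ ≤ k₃` — the SIZES `L₁, L₂, L₃` ARBITRARY); `B′` with zeroth moment `M′ ≥ 0`, `B ≤ B′` on the box, the EXCESS
`B′ − B` ISOTONE; `h`, `h′` ANY box solutions of `B`, `B′` from one pin `p ∈ ]0,γ]`.  Then `h′ ≤ h` at EVERY scale — the first three-age class of the
comparison column; three hyper-separated unit blocks carry kernel mass `T > 1`, beyond every barrier method. [folklore] -/
theorem le_of_isotone_excess_three_ages_far {p : ℝ} {k₁ k₂ k₃ : ℕ} (hL : ∀ k, 0 ≤ L k) (hb : 0 < b) (hk₁ : 1 ≤ k₁) (h12 : 260 * k₁ ≤ k₂)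
    (h23 : 260 * k₂ ≤ k₃) (hk₃K : k₃ < K) (hsupp : ∀ k ∈ range K, k ≠ k₁ → k ≠ k₂ → k ≠ k₃ → L k = 0)
    (hB' : ∀ u u' : ℕ → ℝ, SeqBox γ u → SeqBox γ u' → ∀ D : ℝ, (∀ j, |u j - u' j| ≤ D) → |B' u - B' u'| ≤ M' * D) (hM' : 0 ≤ M')
    (hexc : ∀ u, SeqBox γ u → (fun u : ℕ → ℝ => b + ∑ k ∈ range K, L k * u k) u ≤ B' u)
    (hDmono : ∀ u v : ℕ → ℝ, SeqBox γ u → SeqBox γ v → (∀ j, u j ≤ v j) →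
      B' u - (fun u : ℕ → ℝ => b + ∑ k ∈ range K, L k * u k) u ≤ B' v - (fun u : ℕ → ℝ => b + ∑ k ∈ range K, L k * u k) v)
    (hp : 0 < p) (hpγ : p ≤ γ) (hh : SeqBox γ h) (hf : MemFlow (fun u : ℕ → ℝ => b + ∑ k ∈ range K, L k * u k) p h)
    (hh' : SeqBox γ h') (hf' : MemFlow B' p h') (j : ℕ) : h' j ≤ h j := by
  have hlt12 : k₁ < k₂ := by omega
  have hlt23 : k₂ < k₃ := by omega
  have hcard := card_triple hlt12 hlt23
  refine le_of_isotone_excess_tower_ratio (A := {k₁, k₂, k₃}) (R := 260) hL hb ?_ ?_ ?_ ?_ ?_ hB' hM' hexc hDmono hp hpγ hh hf hh' hf' j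
  · intro k hk
    simp only [Finset.mem_insert, Finset.mem_singleton] at hk
    rcases hk with rfl | rfl | rfl <;> exact mem_range.mpr (by omega)
  · intro k hk
    simp only [Finset.mem_insert, Finset.mem_singleton] at hk
    rcases hk with rfl | rfl | rfl <;> omega
  · intro k hk hkA
    simp only [Finset.mem_insert, Finset.mem_singleton, not_or] at hkA
    exact hsupp k hk hkA.1 hkA.2.1 hkA.2.2
  · intro k hk k' hk' hkk'
    simp only [Finset.mem_insert, Finset.mem_singleton] at hk hk'
    rcases hk with rfl | rfl | rfl <;> rcases hk' with rfl | rfl | rfl <;> omega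
  · rw [hcard]
    obtain ⟨hlo, _⟩ := one_sub_sqrt_two_div_two_bounds
    push_cast
    nlinarith [pow_le_pow_left₀ (by norm_num : (0:ℝ) ≤ 0.2928) hlo.le 3]

end Summit.QuantumFields.BalabanUV.Beta.EriceRemainderEnclosureHistoryAutonomyComparisonTower

end
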